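import Literature.NumberTheory.EllipticCurves.IwasawaAlgebraGeneratorChange
import Literature.NumberTheory.EllipticCurves.IwasawaCharacterPsi
import Literature.NumberTheory.EllipticCurves.Kato2004.AdmissibleZetaClass
import Literature.NumberTheory.EllipticCurves.KatoFineSelmerDualProofs
import Literature.NumberTheory.EllipticCurves.IwasawaGeneratorChangeProofs
import Literature.NumberTheory.EllipticCurves.Kato2004.IwasawaCohomologyUniqueProofs
import Literature.NumberTheory.EllipticCurves.IwasawaAlgebraSemilinearCharIdealProofs
import Literature.NumberTheory.EllipticCurves.ZpExtensionUnitTwistProofs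
import Literature.NumberTheory.GaloisRepresentations.ContinuousCorestrictionRelConj
import HarnessLib

/-!
# Change of `ℤ_p`-extension datum and of topological generator for the two sides of Kato's main
# conjecture: the pinned `𝐇¹_Γ(T_pW)` and the dual fine Selmer group `X₀(E/K_∞)`

[M5 BirchSwinnertonDyer] (Literature support for `Kato2004.kato_mainConjecture_primeT_of_door`,
item stmt-BirchSwinnertonDyer-23168; theorems + plumbing constructions, no new named fact.)

Kato's pinned Iwasawa cohomology `I : IwasawaH1Data W p κ γ` [Ka, §12.2 (p. 220), (13.2)] and the
dual fine Selmer datum `Y : W.FineSelmerDualData κ γ` [Gr, §1] carry the `Λ = ℤ_p⟦T⟧`-structure in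
which `T` acts as `conj_γ − 1` for a chosen topological generator `γ` of `Gal(K_∞/K)` pinned by
`κ γ = 1`.  The cyclotomic `ℤ_p`-extension data `κ : Γ_ℚ →* ℤ_p` of `ℚ` are the unit twists `u • κ₀`
of any one of them (`ZpExtension.IsCyclotomic.exists_eq_unitTwist_holds`), with the SAME kernel and
layers (`ZpExtension.kerSubgroup_unitTwist`, `layerSubgroup_unitTwist`), and a generator `γ` of
`u • κ₀` relates to a generator `γ₀` of `κ₀` through `Ψ_{u•κ₀}(γ₀) = (1+T)^u`.  Washington
[Wa, §13.2]: the isomorphism `ℤ_p⟦Γ⟧ ≅ ℤ_p⟦T⟧` depends on the choice of generator exactly up to the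
automorphism `φ_u : T ↦ (1+T)^u − 1` (`GeneratorChange.substEquiv`, file
`IwasawaAlgebraGeneratorChange`).  This file makes that remark usable for the `(T)`-primary
statements of the tree:

* §1 `castH1`: transport `H¹(U, T) = H¹(U', T)` along an equality `U = U'` of subgroups (plumbing);
* §2 `Ψ_{u•κ₀} = φ_u ∘ Ψ_{κ₀}` (`psi_unitTwist_eq_subst_psi`), `Ψ_{u•κ₀}(γ₀) = (1+T)^u`;
* §3 `IwasawaH1Data.proj_psi_smul`: **the Iwasawa character acts through the Galois action** —
  `proj n (Ψ_κ(σ) • x) = σ · proj n x` for every `σ ∈ Γ_ℚ` (congruence `(1+T)^{κσ} ≡ (1+T)^m (mod ω_n)`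
  from `exists_nat_binomialSeries_sub_pow_mem_span`, then `σ ≡ γ^m` modulo `Gal(ℚ̄/ℚ_n)`);
* §4 `IwasawaH1Data.changeData`: the same group `I.H` with `Λ` acting through `φ_u` and the same layer
  projections IS an `IwasawaH1Data W p κ₀ γ₀`;
* §5 `IsAdmissibleZetaClass.changeData`: Kato's admissible zeta classes [Ka, Conj. 12.10 (p. 224)] for
  `(u•κ₀, γ, I)` are admissible for `(κ₀, γ₀, I.changeData)` (the position clause is built from
  `Ψ`-values, which move by `φ_u`), and `IwasawaH1Data.lengthAt_quotient_span_changeData_eq`: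
  `ℓ_T(𝐇¹_Γ ⧸ Λ z₀)` is the same for both `Λ`-structures (`φ_u` fixes the prime `(T)`,
  `GeneratorChange.comapEquiv_substEquiv_primeT`; lengths are invariant under semilinear isomorphisms,
  `lengthAt_eq_of_semilinearEquiv`);
* §6 the same for `X₀(E/K_∞)` over any number field `K`: `FineSelmerDualData.toDual_psi_smul`
  (from the smoothness of the `Γ`-action along the tower,
  `WeierstrassCurve.exists_forall_mem_layerSubgroup_conjH1_eq` of file `IwasawaGeneratorChangeProofs`,
  which treats the ordinary Selmer datum `SelmerDualData` by comparing kernels `X[Tⁿ]` instead)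
  (`(Ψ_κ(σ) • x)(s) = x(conj_σ s)`), `FineSelmerDualData.changeData` and
  `FineSelmerDualData.lengthAt_changeData_primeT_eq`.

No statement of [Ka], [Gr] or [Wa] beyond the cited remarks is asserted; everything here is proved;
the constructions are transport of structure.

## References
* [Wa] L. C. Washington, *Introduction to Cyclotomic Fields*, 2nd ed., GTM 83, Springer 1997, §13.2
  (the automorphism `T ↦ (1+T)^u − 1` of `Λ`; independence of the generator). [cite: Washington1997, §13.2]
* [Ka] K. Kato, *p-adic Hodge theory and values of zeta functions of modular forms*, Astérisque 295
  (2004), §12.2 (p. 220), Conj. 12.10 (p. 224), Lemma 13.10 (p. 230). [cite: Kato2004Asterisque, §12.2]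
* [Gr] R. Greenberg, *Iwasawa theory for elliptic curves*, LNM 1716 (1999), §1 (held copy, PDF p. 60:
  `H¹(F_∞, E[p^∞])` as a discrete `Λ`-module). [cite: GreenbergLNM1716, §1]
-/
noncomputable section

universe u

open scoped NumberField
open Field IsDedekindDomain CategoryTheory
open Literature.NumberTheory.GaloisRepresentations
open Literature.NumberTheory.EllipticCurves Literature.NumberTheory.EllipticCurves.IwasawaAlgebra
open Literature.NumberTheory.EllipticCurves.Kato2004.EulerSystemValues
open Literature.NumberTheory.EllipticCurves.Module

namespace Literature.NumberTheory.EllipticCurves.Kato2004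

/-! ## §1 Transport of `H¹` classes along an equality of subgroups -/

section Cast

variable {A : Type} [CommRing A] [TopologicalSpace A] {M : Type} [AddCommGroup M] [Module A M]
  [TopologicalSpace M] [IsTopologicalAddGroup M] [ContinuousSMul A M] (T : GaloisRep ℚ A M)

/-- The identification `H¹(U, T) = H¹(U', T)` for EQUAL subgroups `U = U'` of `Γ_ℚ` (transport of
structure; plumbing). [folklore] -/
def castH1 {U U' : Subgroup (absoluteGaloisGroup ℚ)} (h : U = U') : H1 T U ≃ₗ[A] H1 T U' :=
  h ▸ LinearEquiv.refl A (H1 T U)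

/-- `castH1 rfl = id`. [folklore] -/
@[simp] private theorem castH1_rfl {U : Subgroup (absoluteGaloisGroup ℚ)} (x : H1 T U) :
    castH1 T (rfl : U = U) x = x := rfl

/-- `castH1 h.symm` inverts `castH1 h`. [folklore] -/
@[simp] private theorem castH1_symm_apply {U U' : Subgroup (absoluteGaloisGroup ℚ)} (h : U = U') (x : H1 T U') :
    (castH1 T h).symm x = castH1 T h.symm x := by
  subst h; rfl

/-- `castH1 h.symm (castH1 h x) = x`. [folklore] -/
@[simp] private theorem castH1_symm_castH1 {U U' : Subgroup (absoluteGaloisGroup ℚ)} (h : U = U') (x : H1 T U) :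
    castH1 T h.symm (castH1 T h x) = x := by
  subst h; rfl

/-- `castH1 h (castH1 h.symm x) = x`. [folklore] -/
@[simp] private theorem castH1_castH1_symm {U U' : Subgroup (absoluteGaloisGroup ℚ)} (h : U = U') (x : H1 T U') :
    castH1 T h (castH1 T h.symm x) = x := by
  subst h; rfl

/-- Integral classes correspond under `castH1`. [folklore] -/
private theorem castH1_mem_integralH1_iff (p : ℕ) {U U' : Subgroup (absoluteGaloisGroup ℚ)} (h : U = U')
    (x : H1 T U) : castH1 T h x ∈ integralH1 T p U' ↔ x ∈ integralH1 T p U := by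
  subst h; rfl

/-- `castH1` commutes with the Galois action `conjMap`. [folklore] -/
private theorem castH1_conjMap {U U' : Subgroup (absoluteGaloisGroup ℚ)} [U.Normal] [U'.Normal] (h : U = U')
    (g : absoluteGaloisGroup ℚ) (x : H1 T U) :
    castH1 T h (conjMap T.toTopRep U g 1 x) = conjMap T.toTopRep U' g 1 (castH1 T h x) := by
  subst h; rfl

/-- `castH1` commutes with corestrictions along equal pairs of subgroups. [folklore] -/
private theorem castH1_coresLe {V V' U U' : Subgroup (absoluteGaloisGroup ℚ)} (hV : V = V') (hU : U = U')
    (hle : V ≤ U) (hle' : V' ≤ U') (hopen : IsOpen (V : Set (absoluteGaloisGroup ℚ)))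
    (hopen' : IsOpen (V' : Set (absoluteGaloisGroup ℚ)))
    [inst : Fintype (U ⧸ V.subgroupOf U)] [inst' : Fintype (U' ⧸ V'.subgroupOf U')] (x : H1 T V) :
    castH1 T hU (coresLe T.toTopRep hle hopen x) = coresLe T.toTopRep hle' hopen' (castH1 T hV x) := by
  subst hV; subst hU
  have : inst = inst' := Subsingleton.elim _ _
  subst this
  rfl

end Cast

/-! ## §2 The Iwasawa character of a unit twist; layers -/

section PsiTwist

variable {K : Type u} [Field K] {p : ℕ} [Fact p.Prime] {κ : ZpExtension K p} {γ : absoluteGaloisGroup K}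
  (κ₀ : ZpExtension K p) (c : ℤ_[p]ˣ) {γ₀ : absoluteGaloisGroup K}

/-- `σ ≡ γ^m` modulo the `n`-th layer subgroup when `κ σ ≡ m (mod pⁿ)` and `κ γ = 1`. [folklore] -/
private theorem mul_pow_inv_mem_layerSubgroup (hγ : κ.IsTopGenerator γ) (σ : absoluteGaloisGroup K) {n m : ℕ}
    (hm : PadicInt.toZModPow n (κ σ).toAdd = (m : ZMod (p ^ n))) :
    σ * (γ ^ m)⁻¹ ∈ κ.layerSubgroup n := by
  have hγ' : κ γ = Multiplicative.ofAdd 1 := hγ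
  rw [ZpExtension.mem_layerSubgroup, map_mul, map_inv, map_pow, hγ', toAdd_mul, toAdd_inv, ← ofAdd_nsmul,
    toAdd_ofAdd, nsmul_eq_mul, mul_one, ← sub_eq_add_neg]
  have hker : (κ σ).toAdd - (m : ℤ_[p]) ∈ RingHom.ker (PadicInt.toZModPow (p := p) n) := by
    rw [RingHom.mem_ker, map_sub, map_natCast, hm, sub_self]
  rw [PadicInt.ker_toZModPow, Ideal.mem_span_singleton] at hker
  exact_mod_cast hker

/-- `σ ≡ γ^m` modulo the `n`-th layer subgroup (left version): `(γ^m)⁻¹ σ ∈ Gal(K̄/K_n)`. [folklore] -/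
private theorem pow_inv_mul_mem_layerSubgroup (hγ : κ.IsTopGenerator γ) (σ : absoluteGaloisGroup K) {n m : ℕ}
    (hm : PadicInt.toZModPow n (κ σ).toAdd = (m : ZMod (p ^ n))) :
    (γ ^ m)⁻¹ * σ ∈ κ.layerSubgroup n := by
  have h := Subgroup.Normal.conj_mem inferInstance _ (mul_pow_inv_mem_layerSubgroup hγ σ hm) (γ ^ m)⁻¹
  rwa [inv_inv, mul_assoc, inv_mul_cancel_right] at h

/-- `γ^{pⁿ} ∈ Gal(K̄/K_n)` for a topological generator `γ`. [folklore] -/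
private theorem pow_prime_pow_mem_layerSubgroup (hγ : κ.IsTopGenerator γ) (n : ℕ) :
    γ ^ p ^ n ∈ κ.layerSubgroup n := by
  have hγ' : κ γ = Multiplicative.ofAdd 1 := hγ
  rw [ZpExtension.mem_layerSubgroup, map_pow, hγ', ← ofAdd_nsmul, toAdd_ofAdd, nsmul_eq_mul, mul_one, Nat.cast_pow]

/-- `Ψ_{u•κ₀}(γ₀) = (1+T)^c` when `κ₀ γ₀ = 1`: the image of `1 + T` under the change of generator
`φ_c`. [cite: Washington1997, §13.2] -/
theorem psi_unitTwist_of_isTopGenerator (hγ₀ : κ₀.IsTopGenerator γ₀) :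
    ((IwasawaCharacter.Psi p ℤ_[p] (κ₀.unitTwist c) γ₀ : (PowerSeries ℤ_[p])ˣ) : IwasawaAlgebra p) =
      GeneratorChange.subst (c : ℤ_[p]) (1 + PowerSeries.X : IwasawaAlgebra p) := by
  have hγ₀' : κ₀ γ₀ = Multiplicative.ofAdd 1 := hγ₀
  rw [IwasawaCharacter.Psi_apply, IwasawaCharacter.val_onePlusTPow, ZpExtension.unitTwist_apply, hγ₀',
    toAdd_ofAdd, toAdd_ofAdd, mul_one, GeneratorChange.subst_one_add_X]

/-- `Ψ_{u•κ₀}(σ) = φ_c (Ψ_{κ₀}(σ))`: the Iwasawa characters of a datum and of its unit twist differ by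
the change of generator. [cite: Washington1997, §13.2] -/
theorem psi_unitTwist_eq_subst_psi (σ : absoluteGaloisGroup K) :
    ((IwasawaCharacter.Psi p ℤ_[p] (κ₀.unitTwist c) σ : (PowerSeries ℤ_[p])ˣ) : IwasawaAlgebra p) =
      GeneratorChange.subst (c : ℤ_[p])
        ((IwasawaCharacter.Psi p ℤ_[p] κ₀ σ : (PowerSeries ℤ_[p])ˣ) : IwasawaAlgebra p) := by
  rw [IwasawaCharacter.Psi_apply, IwasawaCharacter.Psi_apply, ZpExtension.unitTwist_apply, toAdd_ofAdd,
    GeneratorChange.subst_onePlusTPow]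


end PsiTwist

/-! ## §3 The Iwasawa character acts through the Galois action: `(1+T)^{κσ} • x` projects to `σ · x` -/

section Psi

variable {W : WeierstrassCurve ℚ} [W.IsElliptic] {p : ℕ} [Fact p.Prime]
  [ContinuousSMul ℤ_[p] (W.tateModule p)] {κ : ZpExtension ℚ p} {γ : absoluteGaloisGroup ℚ}
  (I : IwasawaH1Data W p κ γ)

/-- **The Iwasawa character acts through the Galois action on every layer.** For a pinned Iwasawa
cohomology `I : IwasawaH1Data W p κ γ` with `κ γ = 1` (so `1 + T` acts as `conj_γ`), every
`σ ∈ Γ_ℚ` and every layer `n`: `proj n ((1+T)^{κσ} • x) = σ · proj n x`, where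
`(1+T)^{κσ} = Ψ_κ(σ) ∈ Λ` (`IwasawaCharacter.Psi`) and `σ ·` is `conjMap`. Proof: `κσ ≡ m (mod pⁿ)`
gives `(1+T)^{κσ} ≡ (1+T)^m (mod ω_n)` (`exists_nat_binomialSeries_sub_pow_mem_span`), the
`Λ`-action is levelwise (`IwasawaH1Data.proj_smul`), `(1+T)^m` acts as `conj_γ^m = conj_{γ^m}`,
and `σ ≡ γ^m` modulo `Gal(ℚ̄/ℚ_n)`, which acts trivially on `H¹(ℚ_n, T_pW)`.
[cite: Washington1997, §13.2] [cite: Kato2004Asterisque, §12.2 (p. 220)] -/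
theorem IwasawaH1Data.proj_psi_smul (hγ : κ.IsTopGenerator γ) (σ : absoluteGaloisGroup ℚ) (n : ℕ)
    (x : I.H) :
    I.proj n (((IwasawaCharacter.Psi p ℤ_[p] κ σ : (PowerSeries ℤ_[p])ˣ) : IwasawaAlgebra p) • x) =
      conjMap (tateRep W p).toTopRep (κ.layerSubgroup n) σ 1 (I.proj n x) := by
  obtain ⟨m, hm, hmem⟩ := exists_nat_binomialSeries_sub_pow_mem_span (p := p) n (κ σ).toAdd
  -- `Ψ σ = (1+T)^{κσ}` as a power series
  have hΨ : ((IwasawaCharacter.Psi p ℤ_[p] κ σ : (PowerSeries ℤ_[p])ˣ) : IwasawaAlgebra p) =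
      PowerSeries.binomialSeries ℤ_[p] (κ σ).toAdd := by
    rw [IwasawaCharacter.Psi_apply, IwasawaCharacter.val_onePlusTPow]
  -- the congruence in the shape `proj_smul` wants
  have hfr : PowerSeries.binomialSeries ℤ_[p] (κ σ).toAdd - (((Polynomial.X + 1 : Polynomial ℤ_[p]) ^ m : Polynomial ℤ_[p]) : PowerSeries ℤ_[p]) ∈
      Ideal.span {(((Polynomial.X + 1 : Polynomial ℤ_[p]) ^ p ^ n - 1 : Polynomial ℤ_[p]) : PowerSeries ℤ_[p])} := by
    have h1 : (((Polynomial.X + 1 : Polynomial ℤ_[p]) ^ m : Polynomial ℤ_[p]) : PowerSeries ℤ_[p]) = (1 + PowerSeries.X) ^ m := by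
      rw [Polynomial.coe_pow, Polynomial.coe_add, Polynomial.coe_X, Polynomial.coe_one, add_comm]
    have h2 : (((Polynomial.X + 1 : Polynomial ℤ_[p]) ^ p ^ n - 1 : Polynomial ℤ_[p]) : PowerSeries ℤ_[p]) =
        (1 + PowerSeries.X) ^ p ^ n - 1 := by
      rw [Polynomial.coe_sub, Polynomial.coe_pow, Polynomial.coe_add, Polynomial.coe_X, Polynomial.coe_one,
        add_comm]
    rw [h1, h2]
    exact hmem
  rw [hΨ, I.proj_smul hγ n hfr]
  -- `(X+1)^m` evaluated at `conj_γ − 1` is `conj_γ^m = conj_{γ^m}`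
  rw [map_pow, map_add, Polynomial.aeval_X, map_one, sub_add_cancel, conjMap_toLinearMap_pow_apply]
  -- `σ = (σ γ^{-m}) γ^m` with `σ γ^{-m} ∈ Gal(ℚ̄/ℚ_n)` acting trivially
  have hmem' := mul_pow_inv_mem_layerSubgroup hγ σ hm
  conv_rhs => rw [show σ = (σ * (γ ^ m)⁻¹) * γ ^ m by rw [inv_mul_cancel_right]]
  rw [conjMap_mul_apply_one, conjMap_one_apply_of_mem (tateRep W p).toTopRep (κ.layerSubgroup n)
    ⟨σ * (γ ^ m)⁻¹, hmem'⟩]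

/-- Corollary: `((1+T)^{κσ} − 1) • x` projects to `σ · proj n x − proj n x`. [cite: Washington1997, §13.2] -/
theorem IwasawaH1Data.proj_psi_sub_one_smul (hγ : κ.IsTopGenerator γ) (σ : absoluteGaloisGroup ℚ)
    (n : ℕ) (x : I.H) :
    I.proj n ((((IwasawaCharacter.Psi p ℤ_[p] κ σ : (PowerSeries ℤ_[p])ˣ) : IwasawaAlgebra p) - 1) • x) =
      conjMap (tateRep W p).toTopRep (κ.layerSubgroup n) σ 1 (I.proj n x) - I.proj n x := by
  rw [sub_smul, one_smul, map_sub, I.proj_psi_smul hγ]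

end Psi

/-! ## §4 The pinned `𝐇¹_Γ(T_pW)` over a unit twist IS a pinned `𝐇¹_Γ(T_pW)` over the base datum -/

section ChangeData

variable {W : WeierstrassCurve ℚ} [W.IsElliptic] {p : ℕ} [Fact p.Prime]
  [ContinuousSMul ℤ_[p] (W.tateModule p)] (κ₀ : ZpExtension ℚ p) (c : ℤ_[p]ˣ)
  {γ γ₀ : absoluteGaloisGroup ℚ} (I : IwasawaH1Data W p (κ₀.unitTwist c) γ)

/-- `castH1` commutes with the layer corestrictions of a datum and of its unit twist (same layers).
[folklore] -/
private theorem castH1_layerCores (n : ℕ) (y : H1 (tateRep W p) ((κ₀.unitTwist c).layerSubgroup (n + 1))) :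
    castH1 (tateRep W p) (κ₀.layerSubgroup_unitTwist c n) (layerCores (tateRep W p) (κ₀.unitTwist c) n y) =
      layerCores (tateRep W p) κ₀ n (castH1 (tateRep W p) (κ₀.layerSubgroup_unitTwist c (n + 1)) y) := by
  unfold layerCores
  exact castH1_coresLe (inst := (_)) (inst' := (_)) (tateRep W p) (κ₀.layerSubgroup_unitTwist c (n + 1))
    (κ₀.layerSubgroup_unitTwist c n) _ _ _ _ y

/-- **Change of `ℤ_p`-extension datum and generator for the pinned Iwasawa cohomology.** From a pinned
`I : IwasawaH1Data W p (κ₀.unitTwist c) γ` (`T` acting as `conj_γ − 1`, `(u•κ₀) γ = 1`) and a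
topological generator `γ₀` of `κ₀` (`κ₀ γ₀ = 1`), the SAME abelian group `I.H` with `Λ` acting through
the change of generator `φ_c : T ↦ (1+T)^c − 1` (`f ⋆ x := φ_c(f) • x`) and the same layer projections
(the layers of `κ₀` and `u•κ₀` coincide, `ZpExtension.layerSubgroup_unitTwist`) is a pinned
`IwasawaH1Data W p κ₀ γ₀`: `T ⋆ x = ((1+T)^c − 1) • x = (Ψ(γ₀) − 1) • x` projects to `conj_{γ₀} − 1`
(`proj_psi_sub_one_smul`). Washington §13.2: `ℤ_p⟦Γ⟧ ≅ ℤ_p⟦T⟧` depends on the generator only up to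
this automorphism. Plumbing construction (no new mathematics is asserted).
[cite: Washington1997, §13.2] [cite: Kato2004Asterisque, §12.2 (p. 220)] -/
def IwasawaH1Data.changeData (hγ : (κ₀.unitTwist c).IsTopGenerator γ) (hγ₀ : κ₀.IsTopGenerator γ₀) :
    IwasawaH1Data W p κ₀ γ₀ where
  H := I.H
  addCommGroup := I.addCommGroup
  module := Module.compHom I.H ((GeneratorChange.substEquiv c : IwasawaAlgebra p ≃+* IwasawaAlgebra p) :
    IwasawaAlgebra p →+* IwasawaAlgebra p)
  proj n := (castH1 (tateRep W p) (κ₀.layerSubgroup_unitTwist c n)).toLinearMap.toAddMonoidHom.comp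
    (I.proj n)
  proj_mem n x := by
    rw [AddMonoidHom.coe_comp, Function.comp_apply, LinearMap.toAddMonoidHom_coe, LinearEquiv.coe_coe,
      castH1_mem_integralH1_iff]
    exact I.proj_mem n x
  cores_proj n x := by
    simp only [AddMonoidHom.coe_comp, Function.comp_apply, LinearMap.toAddMonoidHom_coe, LinearEquiv.coe_coe]
    rw [← I.cores_proj n x, castH1_layerCores]
  proj_injective x hx := I.proj_injective x fun n ↦ by
    have h := hx n
    simp only [AddMonoidHom.coe_comp, Function.comp_apply, LinearMap.toAddMonoidHom_coe,
      LinearEquiv.coe_coe] at h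
    simpa using congrArg (castH1 (tateRep W p) (κ₀.layerSubgroup_unitTwist c n).symm) h
  proj_surjective y hy := by
    -- pull the family back to the layers of the twist
    set y' : ∀ n : ℕ, H1 (tateRep W p) ((κ₀.unitTwist c).layerSubgroup n) :=
      fun n ↦ castH1 (tateRep W p) (κ₀.layerSubgroup_unitTwist c n).symm (y n) with hy'
    have hy'nc : IsNormCompatible (tateRep W p) (κ₀.unitTwist c) y' := by
      refine ⟨fun n ↦ ?_, fun n ↦ ?_⟩
      · rw [hy', castH1_mem_integralH1_iff]
        exact hy.1 n
      · apply (castH1 (tateRep W p) (κ₀.layerSubgroup_unitTwist c n)).injective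
        rw [hy', castH1_castH1_symm, castH1_layerCores, castH1_castH1_symm]
        exact hy.2 n
    obtain ⟨x, hx⟩ := I.proj_surjective y' hy'nc
    refine ⟨x, fun n ↦ ?_⟩
    simp only [AddMonoidHom.coe_comp, Function.comp_apply, LinearMap.toAddMonoidHom_coe, LinearEquiv.coe_coe]
    rw [hx n, hy', castH1_castH1_symm]
  proj_T_smul n x := by
    simp only [AddMonoidHom.coe_comp, Function.comp_apply, LinearMap.toAddMonoidHom_coe, LinearEquiv.coe_coe]
    letI : Module (IwasawaAlgebra p) I.H := I.module
    change castH1 (tateRep W p) _ (I.proj n ((GeneratorChange.substEquiv c (PowerSeries.X : IwasawaAlgebra p)) • x)) = _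
    rw [GeneratorChange.substEquiv_apply, GeneratorChange.subst_X,
      show PowerSeries.binomialSeries ℤ_[p] (c : ℤ_[p]) - 1 =
        ((IwasawaCharacter.Psi p ℤ_[p] (κ₀.unitTwist c) γ₀ : (PowerSeries ℤ_[p])ˣ) : IwasawaAlgebra p) - 1 by
          rw [psi_unitTwist_of_isTopGenerator κ₀ c hγ₀, GeneratorChange.subst_one_add_X],
      I.proj_psi_sub_one_smul hγ γ₀ n x, map_sub, castH1_conjMap]
  proj_C_smul a n x := by
    simp only [AddMonoidHom.coe_comp, Function.comp_apply, LinearMap.toAddMonoidHom_coe, LinearEquiv.coe_coe]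
    letI : Module (IwasawaAlgebra p) I.H := I.module
    change castH1 (tateRep W p) _ (I.proj n ((GeneratorChange.substEquiv c (PowerSeries.C a : IwasawaAlgebra p)) • x)) = _
    rw [GeneratorChange.substEquiv_apply, GeneratorChange.subst_C, I.proj_C_smul, LinearEquiv.map_smul]

end ChangeData

/-! ## §5 Admissibility and `(T)`-lengths are unchanged by the change of datum/generator -/

section ChangeDataLemmas

variable {W : WeierstrassCurve ℚ} [W.IsElliptic] {p : ℕ} [Fact p.Prime]
  [ContinuousSMul ℤ_[p] (W.tateModule p)] (κ₀ : ZpExtension ℚ p) (c : ℤ_[p]ˣ)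
  {γ γ₀ : absoluteGaloisGroup ℚ} (I : IwasawaH1Data W p (κ₀.unitTwist c) γ)
  (hγ : (κ₀.unitTwist c).IsTopGenerator γ) (hγ₀ : κ₀.IsTopGenerator γ₀)

/-- The `Λ`-action of the changed datum is the old one through `φ_c`: `f ⋆ x = φ_c(f) • x`. [cite: Washington1997, §13.2] -/
theorem IwasawaH1Data.changeData_smul (f : IwasawaAlgebra p) (x : (I.changeData κ₀ c hγ hγ₀).H) :
    (f • x : (I.changeData κ₀ c hγ hγ₀).H) =
      ((GeneratorChange.substEquiv c f) • (show I.H from x) : I.H) := rfl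

/-- The layer projections of the changed datum are those of `I` followed by the identification of
the (equal) layers. [folklore] -/
private theorem IwasawaH1Data.changeData_proj (n : ℕ) (x : (I.changeData κ₀ c hγ hγ₀).H) :
    (I.changeData κ₀ c hγ hγ₀).proj n x =
      castH1 (tateRep W p) (κ₀.layerSubgroup_unitTwist c n) (I.proj n (show I.H from x)) := rfl

/-- `castH1` identifies the two corestrictions from the Euler-system level to the (equal) layers.
[folklore] -/
private theorem castH1_levelToLayer (hK : (κ₀.unitTwist c).IsCyclotomic) (hκ₀ : κ₀.IsCyclotomic) (hp : p ≠ 2)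
    (S : Set (HeightOneSpectrum (𝓞 ℚ))) (n : ℕ)
    (w : H1 (tateRep W p) ((cyclotomicLevelsRat p S).level (n + 1) ∅)) :
    castH1 (tateRep W p) (κ₀.layerSubgroup_unitTwist c n) (levelToLayer W p hK hp S n w) =
      levelToLayer W p hκ₀ hp S n w := by
  unfold levelToLayer
  exact castH1_coresLe (inst := (_)) (inst' := (_)) (tateRep W p) rfl (κ₀.layerSubgroup_unitTwist c n)
    _ _ _ _ w

/-- A ring homomorphism of `Λ` passes through Kato's multiplier (a polynomial expression in its
`Ψ`-arguments with integer coefficients). [cite: Kato2004Asterisque, Lemma 13.10 (1) (p. 230)] -/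
theorem map_katoMultiplier {F : Type*} [FunLike F (IwasawaAlgebra p) (IwasawaAlgebra p)]
    [RingHomClass F (IwasawaAlgebra p) (IwasawaAlgebra p)] (φ : F) (c' d n₁ n₂ n₃ n₄ : ℤ)
    (Ψc Ψd : IwasawaAlgebra p) (E : Finset ℕ) (aℓ εℓ : ℕ → ℤ) (Ψℓ : ℕ → IwasawaAlgebra p) :
    φ (katoMultiplier p c' d n₁ n₂ n₃ n₄ Ψc Ψd E aℓ εℓ Ψℓ) =
      katoMultiplier p c' d n₁ n₂ n₃ n₄ (φ Ψc) (φ Ψd) E aℓ εℓ (fun ℓ ↦ φ (Ψℓ ℓ)) := by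
  unfold katoMultiplier
  simp only [map_mul, map_sub, map_add, map_prod, map_pow, map_intCast, map_natCast]

/-- **Admissibility is preserved by the change of datum/generator**: an admissible Kato zeta class for
`(u•κ₀, γ, I)` is admissible for `(κ₀, γ₀, I.changeData)`. The witnesses are unchanged except: the
layer identity for the `Λ`-adic lift `y` (transported by `castH1_levelToLayer`), and the position clause,
where Kato's multiplier built from `Ψ_{κ₀}` acts through `φ_c`, i.e. AS the multiplier built from
`Ψ_{u•κ₀} = φ_c ∘ Ψ_{κ₀}` (`psi_unitTwist_eq_subst_psi`, `map_katoMultiplier`), and the unit `u` is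
replaced by `φ_c⁻¹(u)`. [cite: Kato2004Asterisque, Conj. 12.10 (p. 224), Lemma 13.10 (1) (p. 230)]
[cite: Washington1997, §13.2] -/
theorem IsAdmissibleZetaClass.changeData [W.IsGloballyMinimal] (hK : (κ₀.unitTwist c).IsCyclotomic)
    (hκ₀ : κ₀.IsCyclotomic) {z₀ : I.H} (hz : IsAdmissibleZetaClass W p (κ₀.unitTwist c) hK I z₀) :
    IsAdmissibleZetaClass W p κ₀ hκ₀ (I.changeData κ₀ c hγ hγ₀) (show (I.changeData κ₀ c hγ hγ₀).H from z₀) := by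
  letI : Module.Free ℤ_[p] (W.tateModule p) := W.module_free_tateModule_holds p
  letI : Module.Finite ℤ_[p] (W.tateModule p) := W.module_finite_tateModule_holds p
  rw [isAdmissibleZetaClass_iff] at hz ⊢
  obtain ⟨hp, N, hN, f, hf, ι, q, Λ, hq, hZ, c', d₁, a, A, d', hA, hc, hd, hdd', hR, z, x, hzeta, y, hy,
    qm, perRatio, e, u, n₁, n₂, n₃, n₄, σc, σd, σℓ, hqm, hspan, h₁, h₂, h₃, h₄, hσc, hσd, hσℓ, hper0, hper,
    he, hpos⟩ := hz
  refine ⟨hp, N, hN, f, hf, ι, q, Λ, hq, hZ, c', d₁, a, A, d', hA, hc, hd, hdd', hR, z, x, hzeta,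
    (show (I.changeData κ₀ c hγ hγ₀).H from y), fun n ↦ ?_, qm, perRatio, e,
    Units.map ((GeneratorChange.substEquiv c).symm : IwasawaAlgebra p →* IwasawaAlgebra p) u,
    n₁, n₂, n₃, n₄, σc, σd, σℓ, hqm, hspan, h₁, h₂, h₃, h₄, hσc, hσd, hσℓ, hper0, hper, he, ?_⟩
  · -- the layer identity for `y`
    rw [IwasawaH1Data.changeData_proj, hy n, castH1_levelToLayer]
  · -- the position clause through `φ_c`
    rw [IwasawaH1Data.changeData_smul, IwasawaH1Data.changeData_smul]
    simp only [map_mul, map_pow, map_natCast, map_katoMultiplier, Units.coe_map, MonoidHom.coe_coe,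
      RingEquiv.apply_symm_apply]
    simp only [GeneratorChange.substEquiv_apply, ← psi_unitTwist_eq_subst_psi]
    exact hpos

/-- **Lengths at `(T)` are unchanged by the change of datum/generator**: for every `z₀ ∈ 𝐇¹_Γ`,
`ℓ_T(𝐇¹_Γ ⧸ Λ⋆z₀) = ℓ_T(𝐇¹_Γ ⧸ Λ•z₀)`, the first quotient for the `Λ`-structure of `I.changeData`
(`T ↦ γ₀ − 1`), the second for that of `I` (`T ↦ γ − 1`): the identity is a semilinear isomorphism
over the ring automorphism `φ_c`, which fixes the prime `(T)` (`lengthAt_eq_of_semilinearEquiv`,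
`GeneratorChange.comapEquiv_substEquiv_primeT`). Washington §13.2: «the automorphism `T ↦ (1+T)^c − 1`
… does not change `λ`, `μ`» — here its `(T)`-primary form. [cite: Washington1997, §13.2] -/
theorem IwasawaH1Data.lengthAt_quotient_span_changeData_eq (z₀ : I.H) :
    lengthAt (IwasawaAlgebra p)
        ((I.changeData κ₀ c hγ hγ₀).H ⧸ Submodule.span (IwasawaAlgebra p)
          {(show (I.changeData κ₀ c hγ hγ₀).H from z₀)}) (primeT p) =
      lengthAt (IwasawaAlgebra p) (I.H ⧸ Submodule.span (IwasawaAlgebra p) {z₀}) (primeT p) := by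
  set σ : IwasawaAlgebra p ≃+* IwasawaAlgebra p := GeneratorChange.substEquiv c with hσ
  set S₀ : Submodule (IwasawaAlgebra p) (I.changeData κ₀ c hγ hγ₀).H :=
    Submodule.span (IwasawaAlgebra p) {(show (I.changeData κ₀ c hγ hγ₀).H from z₀)} with hS₀
  set S : Submodule (IwasawaAlgebra p) I.H := Submodule.span (IwasawaAlgebra p) {z₀} with hS
  -- the identity, semilinear over `φ_c`
  let idₛ : (I.changeData κ₀ c hγ hγ₀).H →ₛₗ[(σ : IwasawaAlgebra p →+* IwasawaAlgebra p)] I.H :=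
    { toFun := fun x ↦ (show I.H from x)
      map_add' := fun _ _ ↦ rfl
      map_smul' := fun _ _ ↦ rfl }
  have hidₛ : ∀ x, idₛ x = (show I.H from x) := fun _ ↦ rfl
  have hle : S₀ ≤ S.comap idₛ := by
    rw [hS₀, Submodule.span_le, Set.singleton_subset_iff, SetLike.mem_coe, Submodule.mem_comap, hidₛ]
    exact Submodule.mem_span_singleton_self z₀
  let e := Submodule.mapQ S₀ S idₛ hle
  have he_mk : ∀ x : (I.changeData κ₀ c hγ hγ₀).H,
      e (Submodule.Quotient.mk x) = Submodule.Quotient.mk (show I.H from x) := fun _ ↦ rfl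
  have hsurj : Function.Surjective e := by
    intro y
    induction y using Submodule.Quotient.induction_on with
    | H x => exact ⟨Submodule.Quotient.mk (show (I.changeData κ₀ c hγ hγ₀).H from x), he_mk _⟩
  have hinj : Function.Injective e := by
    rw [← LinearMap.ker_eq_bot, LinearMap.ker_eq_bot']
    intro m hm
    induction m using Submodule.Quotient.induction_on with
    | H x =>
      rw [he_mk, Submodule.Quotient.mk_eq_zero, hS, Submodule.mem_span_singleton] at hm
      obtain ⟨r, hr⟩ := hm
      rw [Submodule.Quotient.mk_eq_zero, hS₀, Submodule.mem_span_singleton]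
      refine ⟨σ.symm r, ?_⟩
      rw [IwasawaH1Data.changeData_smul, ← hσ, RingEquiv.apply_symm_apply]
      exact hr
  let e' : ((I.changeData κ₀ c hγ hγ₀).H ⧸ S₀) ≃+ (I.H ⧸ S) :=
    AddEquiv.ofBijective e.toAddMonoidHom ⟨hinj, hsurj⟩
  have he' : ∀ (r : IwasawaAlgebra p) (m : (I.changeData κ₀ c hγ hγ₀).H ⧸ S₀), e' (r • m) = σ r • e' m :=
    fun r m ↦ e.map_smulₛₗ r m
  rw [lengthAt_eq_of_semilinearEquiv σ e' he' (primeT p), hσ, GeneratorChange.comapEquiv_substEquiv_primeT]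

end ChangeDataLemmas

end Literature.NumberTheory.EllipticCurves.Kato2004

/-! ## §6 The dual fine Selmer datum `X₀(E/K_∞)` under a change of datum/generator

The same remark for the other side of Kato's main conjecture: the Pontryagin dual of
`Sel₀(K_∞, E[p^∞])` with `T` acting as `conj_γ − 1` (`WeierstrassCurve.FineSelmerDualData W κ γ`,
Greenberg [Gr, §1]: "`Γ` acts naturally on `H¹(F_∞, E[p^∞])` … Thus, `H¹(F_∞, E[p^∞])` is a
`Λ`-module") over a unit twist `u • κ₀` is, through `φ_u`, such a datum over `(κ₀, γ₀)`; the key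
input is again that the Iwasawa character acts through the Galois action (`toDual_psi_smul`), which
rests on the smoothness of the `Γ`-action along the tower
(`WeierstrassCurve.exists_forall_mem_layerSubgroup_conjH1_eq`, file `IwasawaGeneratorChangeProofs`). -/

namespace WeierstrassCurve

open Literature.NumberTheory.EllipticCurves Literature.NumberTheory.EllipticCurves.IwasawaAlgebra
  Literature.NumberTheory.EllipticCurves.Kato2004 Literature.NumberTheory.EllipticCurves.Module

variable {K : Type u} [Field K] [NumberField K] (W : WeierstrassCurve K) {p : ℕ} [Fact p.Prime]
  (κ : ZpExtension K p)

namespace FineSelmerDualData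

variable {W κ} {γ : Field.absoluteGaloisGroup K} (Y : W.FineSelmerDualData κ γ)

/-- `(1+T)^j` acts on `X₀` through `conj_γ^j`: `((1+T)^j • x)(s) = x(conj_γ^j s)` (iterate
`toDual_T_smul`). [cite: GreenbergLNM1716, §1 (after Conj. 1.3)] -/
theorem toDual_onePlusT_pow_smul (j : ℕ) (x : Y.X) (s : W.fineSelmerInfty κ) :
    Y.toDual (((1 + PowerSeries.X : IwasawaAlgebra p) ^ j) • x) s =
      Y.toDual x ((W.conjFineSelmerInfty κ γ ^ j) s) := by
  induction j generalizing x with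
  | zero => rw [pow_zero, one_smul, pow_zero, AddMonoid.End.one_apply]
  | succ j ih =>
    rw [pow_succ, mul_smul, ih, add_smul, one_smul, map_add, AddMonoidHom.add_apply, Y.toDual_T_smul,
      pow_succ', AddMonoid.End.coe_mul, Function.comp_apply, add_sub_cancel]
    rfl

/-- `ω_a = (1+T)^{pᵃ} − 1` kills the values at classes fixed by `conj_γ^{pᵃ}` (private helper).
[folklore] -/
private theorem toDual_omega_mul_smul_eq_zero {a : ℕ} {s : W.fineSelmerInfty κ}
    (hs : (W.conjFineSelmerInfty κ γ ^ p ^ a) s = s) (q : IwasawaAlgebra p) (x : Y.X) :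
    Y.toDual ((((1 + PowerSeries.X : IwasawaAlgebra p) ^ p ^ a - 1) * q) • x) s = 0 := by
  rw [mul_smul, sub_smul, one_smul, map_sub, AddMonoidHom.sub_apply, toDual_onePlusT_pow_smul, hs,
    sub_self]

/-- **The Iwasawa character acts on `X₀(E/K_∞)` through the Galois action**: for a topological
generator `γ` (`T = conj_γ − 1`), every `σ ∈ Γ_K`, `x ∈ X₀` and `s ∈ Sel₀(K_∞, E[p^∞])`,
`(Ψ_κ(σ) • x)(s) = x(conj_σ s)`, `Ψ_κ(σ) = (1+T)^{κσ}`. Proof: `s` is fixed by the `a`-th layer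
(`exists_forall_mem_layerSubgroup_conjH1_eq`, file `IwasawaGeneratorChangeProofs`); `(1+T)^{κσ} ≡ (1+T)^m (mod ω_a)` for `κσ ≡ m (mod pᵃ)`
(`exists_nat_binomialSeries_sub_pow_mem_span`), `ω_a` kills the value at `s`, `(1+T)^m` acts through
`conj_γ^m`, and `σ ≡ γ^m` modulo the `a`-th layer. Greenberg (1999), §1 (the `Λ = ℤ_p⟦Γ⟧`-module
structure of `H¹(F_∞, E[p^∞])`: `Λ` acts through `Γ`). [cite: GreenbergLNM1716, §1 (after Conj. 1.3)]
[cite: Washington1997, §13.2] -/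
theorem toDual_psi_smul (hγ : κ.IsTopGenerator γ) (σ : Field.absoluteGaloisGroup K) (x : Y.X)
    (s : W.fineSelmerInfty κ) :
    Y.toDual (((IwasawaCharacter.Psi p ℤ_[p] κ σ : (PowerSeries ℤ_[p])ˣ) : IwasawaAlgebra p) • x) s =
      Y.toDual x (W.conjFineSelmerInfty κ σ s) := by
  obtain ⟨a, ha⟩ := W.exists_forall_mem_layerSubgroup_conjH1_eq κ (s : W.subgroupH1 p κ.kerSubgroup)
  obtain ⟨m, hm, hmem⟩ := exists_nat_binomialSeries_sub_pow_mem_span (p := p) a (κ σ).toAdd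
  obtain ⟨q, hq⟩ := Ideal.mem_span_singleton'.mp hmem
  have hΨ : ((IwasawaCharacter.Psi p ℤ_[p] κ σ : (PowerSeries ℤ_[p])ˣ) : IwasawaAlgebra p) =
      (1 + PowerSeries.X : IwasawaAlgebra p) ^ m + ((1 + PowerSeries.X) ^ p ^ a - 1) * q := by
    rw [IwasawaCharacter.Psi_apply, IwasawaCharacter.val_onePlusTPow, mul_comm, hq, add_sub_cancel]
  have hfix : (W.conjFineSelmerInfty κ γ ^ p ^ a) s = s := Subtype.ext <| by
    rw [coe_conjFineSelmerInfty_pow_apply]; exact ha _ (pow_prime_pow_mem_layerSubgroup hγ a)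
  rw [hΨ, add_smul, map_add, AddMonoidHom.add_apply, toDual_onePlusT_pow_smul,
    Y.toDual_omega_mul_smul_eq_zero hfix, add_zero]
  congr 1
  apply Subtype.ext
  rw [coe_conjFineSelmerInfty_pow_apply, coe_conjFineSelmerInfty_apply]
  conv_rhs => rw [← mul_inv_cancel_left (γ ^ m) σ, W.conjH1_mul_holds p κ.kerSubgroup,
    AddMonoidHom.comp_apply, ha _ (pow_inv_mul_mem_layerSubgroup hγ σ hm)]

end FineSelmerDualData

/-! ### `Sel₀` over equal subgroups (plumbing) -/

section CastFine

variable {W} {H H' : Subgroup (Field.absoluteGaloisGroup K)} [H.Normal] [H'.Normal]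

variable (W) in
/-- The identification `Sel₀(K̄^H, E[p^∞]) = Sel₀(K̄^{H'}, E[p^∞])` for EQUAL subgroups `H = H'` of `Γ_K`
(transport of structure; plumbing). [folklore] -/
def fineSelmerCast (h : H = H') :
    ↥(GreenbergSelmer.strictSelmerGroupOver H (W.geomPrimaryTorsion p) p
        (GreenbergSelmer.fineData (W.geomPrimaryTorsion p) p)) ≃+
      ↥(GreenbergSelmer.strictSelmerGroupOver H' (W.geomPrimaryTorsion p) p
        (GreenbergSelmer.fineData (W.geomPrimaryTorsion p) p)) := by
  subst h; exact AddEquiv.refl _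

omit [Fact p.Prime] in
/-- `(fineSelmerCast h)⁻¹ = fineSelmerCast h⁻¹`. [folklore] -/
private theorem fineSelmerCast_symm (h : H = H') :
    (W.fineSelmerCast (p := p) h).symm = W.fineSelmerCast h.symm := by
  subst h; rfl

omit [Fact p.Prime] in
/-- `fineSelmerCast` commutes with the conjugation action. [folklore] -/
private theorem coe_fineSelmerCast_conjH1 (h : H = H') (σ : Field.absoluteGaloisGroup K)
    (s : ↥(GreenbergSelmer.strictSelmerGroupOver H (W.geomPrimaryTorsion p) p
        (GreenbergSelmer.fineData (W.geomPrimaryTorsion p) p)))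
    (hs : W.conjH1 p H σ s ∈ GreenbergSelmer.strictSelmerGroupOver H (W.geomPrimaryTorsion p) p
        (GreenbergSelmer.fineData (W.geomPrimaryTorsion p) p)) :
    ((W.fineSelmerCast h ⟨W.conjH1 p H σ s, hs⟩ :
        ↥(GreenbergSelmer.strictSelmerGroupOver H' (W.geomPrimaryTorsion p) p
          (GreenbergSelmer.fineData (W.geomPrimaryTorsion p) p))) : W.subgroupH1 p H') =
      W.conjH1 p H' σ (W.fineSelmerCast h s : ↥(GreenbergSelmer.strictSelmerGroupOver H'
        (W.geomPrimaryTorsion p) p (GreenbergSelmer.fineData (W.geomPrimaryTorsion p) p))) := by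
  subst h; rfl

end CastFine

section CongrFine

variable {W} {κ κ' : ZpExtension K p}

variable (W) in
/-- `Sel₀(K_∞, E[p^∞])` for two `ℤ_p`-extension data with the same top field `K_∞` (equal kernels) is
the same group (transport of structure; plumbing). [folklore] -/
def fineSelmerInftyCongr (h : κ.kerSubgroup = κ'.kerSubgroup) :
    W.fineSelmerInfty κ ≃+ W.fineSelmerInfty κ' :=
  W.fineSelmerCast h

/-- `(fineSelmerInftyCongr h)⁻¹ = fineSelmerInftyCongr h⁻¹`. [folklore] -/
private theorem fineSelmerInftyCongr_symm (h : κ.kerSubgroup = κ'.kerSubgroup) :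
    (W.fineSelmerInftyCongr (p := p) h).symm = W.fineSelmerInftyCongr h.symm :=
  fineSelmerCast_symm h

/-- `fineSelmerInftyCongr` commutes with the conjugation action. [folklore] -/
private theorem coe_fineSelmerInftyCongr_conjH1 (h : κ.kerSubgroup = κ'.kerSubgroup)
    (σ : Field.absoluteGaloisGroup K) (s : W.fineSelmerInfty κ)
    (hs : W.conjH1 p κ.kerSubgroup σ s ∈ W.fineSelmerInfty κ) :
    ((W.fineSelmerInftyCongr h ⟨W.conjH1 p κ.kerSubgroup σ s, hs⟩ : W.fineSelmerInfty κ') :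
        W.subgroupH1 p κ'.kerSubgroup) =
      W.conjH1 p κ'.kerSubgroup σ (W.fineSelmerInftyCongr h s : W.fineSelmerInfty κ') :=
  coe_fineSelmerCast_conjH1 h σ s hs

end CongrFine

namespace FineSelmerDualData

variable {W} (κ₀ : ZpExtension K p) (c : ℤ_[p]ˣ) {γ γ₀ : Field.absoluteGaloisGroup K}
  (Y : W.FineSelmerDualData (κ₀.unitTwist c) γ)

/-- The identification `X ≃ Hom(Sel₀(K_∞), ℚ/ℤ)` of `Y` read over `κ₀` (same top field `K_∞`:
`ker (u•κ₀) = ker κ₀`, `ZpExtension.kerSubgroup_unitTwist`); plumbing. [folklore] -/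
def toDualChange : Y.X →+ (W.fineSelmerInfty κ₀ →+ AddCircle (1 : ℚ)) :=
  (AddEquiv.addMonoidHomCongrLeft
      (W.fineSelmerInftyCongr (p := p) (κ₀.kerSubgroup_unitTwist c))).toAddMonoidHom.comp Y.toDual

/-- `toDualChange` is bijective (an additive equivalence after `toDual`). [folklore] -/
private theorem toDualChange_bijective : Function.Bijective (Y.toDualChange κ₀ c) :=
  (AddEquiv.addMonoidHomCongrLeft (N := AddCircle (1 : ℚ))
      (W.fineSelmerInftyCongr (p := p) (κ₀.kerSubgroup_unitTwist c))).bijective.comp Y.bijective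

/-- Unfolding `toDualChange`: `x ↦ (s ↦ x(s))` along the identification of the two `Sel₀`.
[folklore] -/
private theorem toDualChange_apply (x : Y.X) (s : W.fineSelmerInfty κ₀) :
    Y.toDualChange κ₀ c x s =
      Y.toDual x (W.fineSelmerInftyCongr (p := p) (κ₀.kerSubgroup_unitTwist c).symm s) := by
  rw [← fineSelmerInftyCongr_symm]; rfl

/-- `φ_c(T) = (1+T)^c − 1 = Ψ_{u•κ₀}(γ₀) − 1` acts on `Y` as `conj_{γ₀} − 1` (private helper).
[cite: Washington1997, §13.2] -/
private theorem toDual_substEquiv_X_smul (hγ : (κ₀.unitTwist c).IsTopGenerator γ)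
    (hγ₀ : κ₀.IsTopGenerator γ₀) (x : Y.X) (t : W.fineSelmerInfty (κ₀.unitTwist c)) :
    Y.toDual ((GeneratorChange.substEquiv c (PowerSeries.X : IwasawaAlgebra p)) • x) t =
      Y.toDual x (W.conjFineSelmerInfty (κ₀.unitTwist c) γ₀ t) - Y.toDual x t := by
  rw [GeneratorChange.substEquiv_apply, GeneratorChange.subst_X,
    show PowerSeries.binomialSeries ℤ_[p] (c : ℤ_[p]) - 1 =
      ((IwasawaCharacter.Psi p ℤ_[p] (κ₀.unitTwist c) γ₀ : (PowerSeries ℤ_[p])ˣ) : IwasawaAlgebra p) - 1 by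
        rw [psi_unitTwist_of_isTopGenerator κ₀ c hγ₀, GeneratorChange.subst_one_add_X],
    sub_smul, one_smul, map_sub, AddMonoidHom.sub_apply, Y.toDual_psi_smul hγ]

/-- **Change of `ℤ_p`-extension datum and generator for the dual fine Selmer group.** From
`Y : W.FineSelmerDualData (u•κ₀) γ` (`X₀(E/K_∞)` with `T = conj_γ − 1`) and a topological generator
`γ₀` of `κ₀`: the SAME group `Y.X` with `Λ` acting through `φ_u : T ↦ (1+T)^u − 1` and the same
identification with `Hom(Sel₀(K_∞), ℚ/ℤ)` (same `K_∞`) is a `W.FineSelmerDualData κ₀ γ₀`: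
`T ⋆ x = ((1+T)^u − 1) • x = (Ψ(γ₀) − 1) • x` is `x ∘ (conj_{γ₀} − 1)` (`toDual_psi_smul`), constants
are fixed by `φ_u`. Plumbing construction (no new mathematics is asserted).
[cite: GreenbergLNM1716, §1 (after Conj. 1.3)] [cite: Washington1997, §13.2] -/
def changeData (hγ : (κ₀.unitTwist c).IsTopGenerator γ) (hγ₀ : κ₀.IsTopGenerator γ₀) :
    W.FineSelmerDualData κ₀ γ₀ where
  X := Y.X
  addCommGroup := Y.addCommGroup
  module := Module.compHom Y.X ((GeneratorChange.substEquiv c : IwasawaAlgebra p ≃+* IwasawaAlgebra p) :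
    IwasawaAlgebra p →+* IwasawaAlgebra p)
  toDual := Y.toDualChange κ₀ c
  bijective := Y.toDualChange_bijective κ₀ c
  toDual_T_smul x s := by
    letI : Module (IwasawaAlgebra p) Y.X := Y.module
    change Y.toDualChange κ₀ c ((GeneratorChange.substEquiv c (PowerSeries.X : IwasawaAlgebra p)) • x) s = _
    rw [toDualChange_apply, toDualChange_apply, toDualChange_apply, Y.toDual_substEquiv_X_smul κ₀ c hγ hγ₀]
    congr 2
    apply Subtype.ext
    rw [coe_conjFineSelmerInfty_apply]
    exact (coe_fineSelmerInftyCongr_conjH1 (W := W) (κ₀.kerSubgroup_unitTwist c).symm γ₀ s _).symm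
  toDual_C_smul a x s k hk := by
    letI : Module (IwasawaAlgebra p) Y.X := Y.module
    change Y.toDualChange κ₀ c ((GeneratorChange.substEquiv c (PowerSeries.C a : IwasawaAlgebra p)) • x) s = _
    rw [toDualChange_apply, toDualChange_apply, GeneratorChange.substEquiv_apply, GeneratorChange.subst_C]
    exact Y.toDual_C_smul a x _ k (by rw [← map_nsmul, hk, map_zero])

/-- The `Λ`-action of the changed datum is the old one through `φ_c`. [cite: Washington1997, §13.2] -/
theorem changeData_smul (hγ : (κ₀.unitTwist c).IsTopGenerator γ) (hγ₀ : κ₀.IsTopGenerator γ₀)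
    (f : IwasawaAlgebra p) (x : (Y.changeData κ₀ c hγ hγ₀).X) :
    (f • x : (Y.changeData κ₀ c hγ hγ₀).X) = ((GeneratorChange.substEquiv c f) • (show Y.X from x) : Y.X) :=
  rfl

/-- **`ℓ_T(X₀)` is unchanged by the change of datum/generator**: the identity of `Y.X` is semilinear
over `φ_c`, which fixes `(T)` (`lengthAt_eq_of_semilinearEquiv`,
`GeneratorChange.comapEquiv_substEquiv_primeT`). [cite: Washington1997, §13.2] -/
theorem lengthAt_changeData_primeT_eq (hγ : (κ₀.unitTwist c).IsTopGenerator γ)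
    (hγ₀ : κ₀.IsTopGenerator γ₀) :
    lengthAt (IwasawaAlgebra p) (Y.changeData κ₀ c hγ hγ₀).X (primeT p) =
      lengthAt (IwasawaAlgebra p) Y.X (primeT p) := by
  have h := lengthAt_eq_of_semilinearEquiv (GeneratorChange.substEquiv c)
    (show (Y.changeData κ₀ c hγ hγ₀).X ≃+ Y.X from AddEquiv.refl Y.X) (fun _ _ ↦ rfl) (primeT p)
  rwa [GeneratorChange.comapEquiv_substEquiv_primeT] at h

end FineSelmerDualData

end WeierstrassCurve

end
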